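import Literature.MathematicalPhysics.QuantumFieldTheory.Balaban1983to89.B9GradLetterTransportedInputClasses
import Literature.MathematicalPhysics.QuantumFieldTheory.Balaban1983to89.B9Thm313WholeDvFromDdsAnyNorm

/-!
# `Balaban1983to89.B9GradLetterTransportedInputClassesPI` — [B9] (3.3) p. 391 + (3.40) p. 397 + (3.45) p. 398: THE LETTER `J_μ` BETWEEN THE PRINT-EXACT TRANSPORTED INPUT
# CLASSES `bHZPIfam (taxiS U) ε → bHZKPIfam (taxiB U) ε` (every `ε > 0`), THE LADDER HYPOTHESIS FROM (3.35), AND THE HÖLDER-SOURCE MEMBERS `∇_{U,ν}G₀D_U ∕ Φ^X_β∇_{U,ν}G₀D_U`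
# FROM THE TRANSPORTED SITE CLASS — the per-member core of the `hdgDvd13 ∕ hpdgDvd13` LEG

T. Bałaban, *Propagators for lattice gauge theories in a background field*, Commun. Math. Phys. **99** (1985) 389–434 [`Balaban1985BackgroundPropagators`]; [4] = T. Bałaban,
*Propagators and renormalization transformations for lattice gauge theories. II*, Commun. Math. Phys. **96** (1984) 223–250 [`Balaban1984PropagatorsII`].
statement-level skeleton of published theorems with citation tags; proofs where landed; nothing here is a claim about the Yang–Mills mass gap.

THE PRINT.  (3.3) p. 391 (D_U = Σ_μ ∇\*_{U,μ}∘J_μ); (3.40) p. 397 (transported Hölder quotient); (3.44)–(3.45) p. 398 (*"|(∇_UG(U)∇\*_Uλ)(x)| ≦ B′₀(ε)e^{−δ₀d(y,y′)}(‖λ‖^{ξ′}_ε + |λ|)"*,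
its probe form with `(Lʲη)^{−β}`); (3.35) p. 396; [4] Lemma 2.1 (2.60) p. 234 (one scale power between neighbouring blocks), (2.51)–(2.56) pp. 232–233.

WHY THIS FILE (cell `pub-ymgap`, node N06 [B9], seat `pub-ymgap-dag-n06-c` g21; `LOCATED22-ADOPTION-MEMO-g21.md` §3.3).  D1b (`B9GradLetterTransportedInputClasses.hasMaj_JcoKH_bHZP_bHZKP`)
is stated at dag-n06-l's print-WEIGHTED classes and modulo the ladder hypothesis; the certificate's transported input classes are the print-EXACT total families
`bHXT x U = bHZPIfam (taxiS U)`, `bHXTA x U = bHZKPIfam (taxiB U)` (ED.95 `hbHXT ∕ hbHXTA`).  THIS FILE closes the gap: §1 ★★ `hasMaj_JcoKH_bHZPI_bHZKPI` (re-weighting by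
`Lʲη` on both sides, the ratio `Lʲη∕Lʲ′η ≤ L·e^{εd}` by (2.60) above its threshold — the twin of `B9SmoothHolderClassPI.hasMaj_dirSliceK_bHZKPI_bHZPI`), `bHZPIfam_of_not_mem ∕
bHZKPIfam_of_not_mem`, ★★ `hasMaj_JcoKH_fam` (EVERY `ε > 0`: on `(0,1]` the class at `s = ε`, beyond `1` both families are the `s = ½` classes); §2 ★★ `jLadder_hyp_of_reg335P`
(D1a's `norm_jLadder_sub_one_le_of_reg335P` in the exact shape of the hypothesis `hlad`, `Θ = (d+1)·K_pl·L⁶`, admissible pairs are near at the second point); §3 ★★★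
`hasMaj_dgDv_of_h44m` ∕ ★★★ `hasMaj_pdgDv_of_h45m` — for ONE member and configuration: from the G₀ layer's (3.45) members at the transported BOND class
(`Thm33G0Dir.h44m ∕ .h45m` shapes, hypotheses) and the pinned direction letter, `∇_{U,ν}∘G₀∘D_U` (resp. `Φ^X_β∘∇_{U,ν}∘G₀∘D_U`) from the transported SITE class into the
blocks (resp. the probe blocks with `(Lʲη)^{−β}`) — `B9Thm313WholeDvFromDdsAnyNorm.word_dv_of_members(_tw)` over §1 and def-Y's `DvcoKH_eq_sum`.  The member-uniform
thresholds and the certificate's binder shapes are the LEG `Summits/…/BalabanUVNodesN06DgDvdLegAtPinsT`.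

HONEST SCOPE.  Class bookkeeping + majorant algebra over landed modules; the G₀ members are HYPOTHESES; nothing of [B9]'s estimates asserted; COUNT-NEUTRAL; N06 NOT discharged;
nothing continuum, nothing about the mass gap.  A NEW file; 0 `def`, no `sorry`, no `axiom`, no `instance`, no `notation`.
-/

noncomputable section

namespace Literature.MathematicalPhysics.QuantumFieldTheory.Balaban1983to89.B9GradLetterTransportedInputClassesPI

open T4RelativeLadder (UnitaryLike)
open B4TorusKernel.MultiPeriod (torusSupNorm torusSupNorm_nonneg)
open B6GlobalChartV1 (PV blkV1 boxEquiv)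
open B6Geom246MultiLevelTorus (geomT torusSupNorm_neg)
open B6Ineq2142KLevelV1 (β lvl)
open B6KLevelCensusIndexV1 (KIdx kGeo Adm)
open B6MultiLevelTorusOperator (one_le_of_mem)
open B6Prop22KLevelTorusCensusEta (nKT nKT_pos)
open B9BackgroundsKLevelV1P (bg9KP)
open B9GeoNormsKLevelV1 (geo9K geo9K_dist_nonneg)
open B9GeoLemma21KLevelV1 (geo9K_len_pos geo9K_dist_comm)
open B9Thm34Ext (toB6)
open B9SectDSup (weightNorm)
open B11SectG (BlockNorm HasMaj RowSum)
open B9CoReadingCoords (XBK coordOpK cdsBₗ)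
open B9CoReadingCoordsS (XSK)
open B9MultiscaleSmoothPartitionYLip (CLip CLip_nonneg)
open B9MultiscaleSmoothPartitionYNear (rNear)
open B9SmoothHolderClassP (bHZP bHZKP)
open B9SmoothHolderClassPI (bHZPI bHZKPI bHZPIfam bHZKPIfam bHZPIfam_of_mem bHZKPIfam_of_mem bHZKPI_κ len_le_transfer_geo9K)
open B9GradViaDivLettersSmoothTerms (blkV1_level_eq_levY)
open B9GradViaDivLettersTransported (taxiS taxiB)
open B9GradViaDivLettersAtPins (JcoKH DvcoKH_eq_sum)
open B9GradLetterLadderHolonomy (norm_jLadder_sub_one_le_of_reg335P)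
open B9GradLetterTransportedInputClasses (hasMaj_JcoKH_bHZP_bHZKP)
open B9Eq340ProbeBridgeSNtoKA (supDist_eq_torusSupNorm)
open B9Thm39ReadingCoords (coordBound39 basisBound39)
open B9Thm312Whole (GeoOK)
open B9Thm313WholeDvFromDdsAnyNorm (word_dv_of_members word_dv_of_members_tw)
open Node00 (SiteY FBondY IBondY CfgY toKT levY parTaxiV)
open Node00.OpsYNablaBridge (chartY)
open Node00.OpsYSectDCoords (DvcoKH)
open LatticeFieldCalculus (supDist)

variable {d ℓ : ℕ} {hd : 1 ≤ d + 1} {hL : Odd (ℓ + 1) ∧ 1 < ℓ + 1} {b₀ b₁ : ℝ}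
variable {𝔸 : Type} [NormedRing 𝔸] [NormedAlgebra ℂ 𝔸] [CompleteSpace 𝔸]
variable {κ : Type} [Fintype κ]
variable (i : KIdx d ℓ hd hL b₀ b₁) [Fintype (geo9K i).Site] (b : Module.Basis κ ℝ 𝔸) {B : B9.Backgrounds} (cfg : B.Cfg → CfgY 𝔸 i) (U₁ : B.Cfg)
variable {R₀ : ℝ} {H₀ : Prop} {bI : FBondY i → IBondY i}

/-! ## §1 The letter between the print-exact classes and the total families -/

section Fam

/-- ★★ **`J_μ : bHZPI (taxiS U) s → bHZKPI (taxiB U) s`** (both sides re-weighted by `Lʲη`; the ratio `Lʲη∕Lʲ′η ≤ L·e^{εd(y,y′)}` by [4] (2.60) above its threshold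
`log L ≤ ε(2L²−1)M`): majorant `L·C_J·e^{δr}·e^{−(δ−ε)d}`, `C_J, r` of D1b. [cite: Balaban1985BackgroundPropagators, (3.40) p.397 + (3.44)–(3.45) p.398 + (3.3) p.391; Balaban1984PropagatorsII, Lemma 2.1 (2.60) p.234] -/
theorem hasMaj_JcoKH_bHZPI_bHZKPI [NormOneClass 𝔸] [FiniteDimensional ℝ 𝔸] (hU : ∀ μ' t, UnitaryLike (cfg U₁ μ' t))
    (hβ1 : ∀ f : FBondY i, (geomT i.D).dist (β i.hN i.D i.hk (bI f)) (blkV1 i.hN i.D f) ≤ 1) (hcf : |i.cf| = (nKT (toKT i) : ℝ))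
    {s : ℝ} (hs0 : 0 < s) (hs1 : s ≤ 1) {δ ε : ℝ} (hδ : 0 ≤ δ) (hε : 0 < ε)
    (hM : Real.log (geo9K i).L ≤ ε * (2 * ((ℓ : ℝ) + 1) ^ 2 - 1) * (geo9K i).M) (μ : Fin (d + 1)) {Θ : ℝ} (hΘ : 0 ≤ Θ)
    (hlad : ∀ x x' : Site (PV d ℓ i.m i.K hd hL) 0, Adm i ⟨x, μ⟩ ⟨x', μ⟩ →
      ‖((parTaxiV (cfg U₁) x x' * cfg U₁ μ x' * (parTaxiV (cfg U₁) (x.shift μ) (x'.shift μ))⁻¹ * (cfg U₁ μ x)⁻¹ : 𝔸ˣ) : 𝔸) - 1‖ ≤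
        Θ * ((supDist x x' : ℝ) / (((ℓ + 1 : ℕ) : ℝ)) ^ levY i (chartY i x'))) :
    HasMaj (bHZPI (κ := κ) i b (taxiS i B cfg U₁) (R := R₀) (H := H₀) hs0.le hs1)
      (bHZKPI (κ := κ) i b (taxiB i B cfg U₁) (R := R₀) (H := H₀) hs0.le hs1) (JcoKH i b B cfg μ U₁)
      (fun y y' => (((ℓ + 1 : ℕ) : ℝ)) * ((((ℓ + 1 : ℕ) : ℝ)) ^ 4 * coordBound39 b * basisBound39 b * (3 + 2 * (((ℓ + 1 : ℕ) : ℝ)) ^ 2 + 2 * Θ * (((ℓ + 1 : ℕ) : ℝ)) ^ 3)) *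
        Real.exp (δ * (2 * (rNear d ℓ + 1) + 2 * (((d : ℝ) + 1) * (((ℓ : ℝ) + 1) + 1) + 2))) * Real.exp (-((δ - ε) * (geo9K i).dist y y'))) := by
  have hB1 := hasMaj_JcoKH_bHZP_bHZKP (κ := κ) i b cfg U₁ (R₀ := R₀) (H₀ := H₀) (bI := bI) hU hβ1 hcf hs0 hs1 hδ μ hΘ hlad
  have hT := len_le_transfer_geo9K i hε hM
  set Cσ : ℝ := (((ℓ + 1 : ℕ) : ℝ)) ^ 4 * coordBound39 b * basisBound39 b * (3 + 2 * (((ℓ + 1 : ℕ) : ℝ)) ^ 2 + 2 * Θ * (((ℓ + 1 : ℕ) : ℝ)) ^ 3) with hCσ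
  set Eσ : ℝ := Real.exp (δ * (2 * (rNear d ℓ + 1) + 2 * (((d : ℝ) + 1) * (((ℓ : ℝ) + 1) + 1) + 2))) with hEσ
  have hcb : 0 ≤ coordBound39 b := by unfold coordBound39; exact norm_nonneg _
  have hbb : 0 ≤ basisBound39 b := Finset.sum_nonneg fun _ _ => norm_nonneg _
  have hC0 : 0 ≤ Cσ * Eσ := by rw [hCσ, hEσ]; positivity
  refine B9SectDSup.HasMaj.weight (fun y => (geo9K_len_pos i y).le) (fun y => (geo9K_len_pos i y).le) hB1 fun y y' => ?_
  have hsymm : (geo9K i).dist y' y = (geo9K i).dist y y' := geo9K_dist_comm i y' y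
  have hy : (geo9K i).len y ≤ (((ℓ + 1 : ℕ) : ℝ)) * Real.exp (ε * (geo9K i).dist y y') * (geo9K i).len y' := by
    have h := hT y' y
    rwa [hsymm] at h
  have hE0 : 0 ≤ Real.exp (-(δ * (geo9K i).dist y y')) := Real.exp_nonneg _
  calc (geo9K i).len y * (Cσ * Eσ * Real.exp (-(δ * (geo9K i).dist y y')))
      ≤ ((((ℓ + 1 : ℕ) : ℝ)) * Real.exp (ε * (geo9K i).dist y y') * (geo9K i).len y') * (Cσ * Eσ * Real.exp (-(δ * (geo9K i).dist y y'))) :=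
        mul_le_mul_of_nonneg_right hy (mul_nonneg hC0 hE0)
    _ = (((ℓ + 1 : ℕ) : ℝ)) * Cσ * Eσ * (Real.exp (-(δ * (geo9K i).dist y y')) * Real.exp (ε * (geo9K i).dist y y')) * (geo9K i).len y' := by ring
    _ = (((ℓ + 1 : ℕ) : ℝ)) * Cσ * Eσ * Real.exp (-((δ - ε) * (geo9K i).dist y y')) * (geo9K i).len y' := by
        rw [← Real.exp_add]; congr 3; ring

omit [CompleteSpace 𝔸] in
/-- beyond `[0,1]` the site family is the `s = ½` class. [cite: Balaban1985BackgroundPropagators, (3.44) p.398, bookkeeping] -/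
theorem bHZPIfam_of_not_mem (g : SiteY i → SiteY i → 𝔸ˣ) {R : ℝ} {H : Prop} {ε : ℝ} (h : ¬ (0 ≤ ε ∧ ε ≤ 1)) :
    bHZPIfam (κ := κ) i b g (R := R) (H := H) ε = bHZPI (κ := κ) i b g (R := R) (H := H) (s := 1 / 2) (by norm_num) (by norm_num) := by
  unfold bHZPIfam
  rw [dif_neg h]

omit [CompleteSpace 𝔸] in
/-- beyond `[0,1]` the bond family is the `s = ½` class. [cite: Balaban1985BackgroundPropagators, (3.44) p.398, bookkeeping] -/
theorem bHZKPIfam_of_not_mem (g : FBondY i → FBondY i → 𝔸ˣ) {R : ℝ} {H : Prop} {ε : ℝ} (h : ¬ (0 ≤ ε ∧ ε ≤ 1)) :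
    bHZKPIfam (κ := κ) i b g (R := R) (H := H) ε = bHZKPI (κ := κ) i b g (R := R) (H := H) (s := 1 / 2) (by norm_num) (by norm_num) := by
  unfold bHZKPIfam
  rw [dif_neg h]

/-- ★★ **`J_μ` BETWEEN THE TOTAL FAMILIES, EVERY `ε > 0`** (on `(0,1]` the print-exact class at `s = ε`; beyond `1` both families are the `s = ½` classes): the same majorant.
[cite: Balaban1985BackgroundPropagators, (3.40) p.397 + (3.44)–(3.45) p.398 + (3.3) p.391; Balaban1984PropagatorsII, Lemma 2.1 (2.60) p.234] -/
theorem hasMaj_JcoKH_fam [NormOneClass 𝔸] [FiniteDimensional ℝ 𝔸] (hU : ∀ μ' t, UnitaryLike (cfg U₁ μ' t))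
    (hβ1 : ∀ f : FBondY i, (geomT i.D).dist (β i.hN i.D i.hk (bI f)) (blkV1 i.hN i.D f) ≤ 1) (hcf : |i.cf| = (nKT (toKT i) : ℝ))
    {δ ε : ℝ} (hδ : 0 ≤ δ) (hε : 0 < ε) (hM : Real.log (geo9K i).L ≤ ε * (2 * ((ℓ : ℝ) + 1) ^ 2 - 1) * (geo9K i).M) (μ : Fin (d + 1)) {Θ : ℝ} (hΘ : 0 ≤ Θ)
    (hlad : ∀ x x' : Site (PV d ℓ i.m i.K hd hL) 0, Adm i ⟨x, μ⟩ ⟨x', μ⟩ →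
      ‖((parTaxiV (cfg U₁) x x' * cfg U₁ μ x' * (parTaxiV (cfg U₁) (x.shift μ) (x'.shift μ))⁻¹ * (cfg U₁ μ x)⁻¹ : 𝔸ˣ) : 𝔸) - 1‖ ≤
        Θ * ((supDist x x' : ℝ) / (((ℓ + 1 : ℕ) : ℝ)) ^ levY i (chartY i x')))
    {ε' : ℝ} (hε' : 0 < ε') :
    HasMaj (bHZPIfam (κ := κ) i b (taxiS i B cfg U₁) (R := R₀) (H := H₀) ε') (bHZKPIfam (κ := κ) i b (taxiB i B cfg U₁) (R := R₀) (H := H₀) ε') (JcoKH i b B cfg μ U₁)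
      (fun y y' => (((ℓ + 1 : ℕ) : ℝ)) * ((((ℓ + 1 : ℕ) : ℝ)) ^ 4 * coordBound39 b * basisBound39 b * (3 + 2 * (((ℓ + 1 : ℕ) : ℝ)) ^ 2 + 2 * Θ * (((ℓ + 1 : ℕ) : ℝ)) ^ 3)) *
        Real.exp (δ * (2 * (rNear d ℓ + 1) + 2 * (((d : ℝ) + 1) * (((ℓ : ℝ) + 1) + 1) + 2))) * Real.exp (-((δ - ε) * (geo9K i).dist y y'))) := by
  by_cases h1 : ε' ≤ 1
  · rw [bHZPIfam_of_mem i b _ hε'.le h1, bHZKPIfam_of_mem i b _ hε'.le h1]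
    exact hasMaj_JcoKH_bHZPI_bHZKPI i b cfg U₁ hU hβ1 hcf hε' h1 hδ hε hM μ hΘ hlad
  · have hn : ¬ (0 ≤ ε' ∧ ε' ≤ 1) := fun h => h1 h.2
    rw [bHZPIfam_of_not_mem i b _ hn, bHZKPIfam_of_not_mem i b _ hn]
    exact hasMaj_JcoKH_bHZPI_bHZKPI i b cfg U₁ hU hβ1 hcf (by norm_num) (by norm_num) hδ hε hM μ hΘ hlad

end Fam

/-! ## §2 The ladder hypothesis under print's (3.35) -/

section Ladder

omit [Fintype (geo9K i).Site] in
open scoped Matrix.Norms.L2Operator in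
/-- ★★ **THE LADDER HYPOTHESIS `hlad` OF D1b FROM (3.35)** at node00-def-Y's letters in the matrix algebra (`bg9KP`, `c ≤ 10`, `G` unit-normed, `Mα₀ ≥ 0`): on every admissible
bond pair of direction `μ`, `‖U(Γ_{x,x′})U_μ(x′)U(Γ_{x+e_μ,x′+e_μ})⁻¹U_μ(x)⁻¹ − 1‖ ≤ Θ·|x−x′|_∞∕L^{j(x′)}` with `Θ = (d+1)·K_pl·L⁶` (D1a at the pair, near at its second point).
[cite: Balaban1985BackgroundPropagators, (3.40) p.397 + (3.35) p.396 + (3.69) p.404; Balaban1984PropagatorsII, (2.137) p.247] -/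
theorem jLadder_hyp_of_reg335P {N : ℕ} [Nonempty (Fin N)] {G : Subgroup (Matrix (Fin N) (Fin N) ℂ)ˣ}
    (U : CfgY (Matrix (Fin N) (Fin N) ℂ) i) {c α₀ : ℝ} (hc : c ≤ 10) (hMα : 0 ≤ (kGeo i).M * α₀)
    (hreg : (bg9KP (Matrix (Fin N) (Fin N) ℂ) G i).Reg335 c α₀ U) (hG1 : ∀ u : (Matrix (Fin N) (Fin N) ℂ)ˣ, u ∈ G → ‖(u : Matrix (Fin N) (Fin N) ℂ)‖ ≤ 1)
    (μ : Fin (d + 1)) (x x' : Site (PV d ℓ i.m i.K hd hL) 0) (hadm : Adm i ⟨x, μ⟩ ⟨x', μ⟩) :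
    ‖((parTaxiV U x x' * U μ x' * (parTaxiV U (x.shift μ) (x'.shift μ))⁻¹ * (U μ x)⁻¹ : (Matrix (Fin N) (Fin N) ℂ)ˣ) : Matrix (Fin N) (Fin N) ℂ) - 1‖ ≤
      ((((d + 1 : ℕ) : ℝ)) * (2 * (10 * (kGeo i).L * ((kGeo i).M * α₀)) * (1 + 10 * (kGeo i).L * ((kGeo i).M * α₀)) * Real.exp (4 * (10 * (kGeo i).L * ((kGeo i).M * α₀))))
        * (kGeo i).L ^ 6) * ((supDist x x' : ℝ) / (((ℓ + 1 : ℕ) : ℝ)) ^ levY i (chartY i x')) := by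
  -- the pair is near at its second point
  have hnear : torusSupNorm (toKT i).NB ((chartY i x').1 - (chartY i x).1) ≤ (((ℓ + 1 : ℕ) : ℝ)) ^ levY i (chartY i x') := by
    have h1 : (blkV1 i.hN i.D (⟨x', μ⟩ : FBondY i)).1.1 = levY i (chartY i x') :=
      blkV1_level_eq_levY (κ := Unit) i ((⟨x', μ⟩ : FBondY i), μ, (), ())
    rw [← supDist_eq_torusSupNorm i x x', ← h1]
    exact_mod_cast hadm.2.2
  have hlad := norm_jLadder_sub_one_le_of_reg335P i U hc hMα hreg hG1 (z := chartY i x') (w := chartY i x) hnear μ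
  have e1 : (boxEquiv i.hN).symm (chartY i x) = x := (boxEquiv i.hN).symm_apply_apply x
  have e2 : (boxEquiv i.hN).symm (chartY i x') = x' := (boxEquiv i.hN).symm_apply_apply x'
  rw [e1, e2] at hlad
  refine hlad.trans ?_
  set Kpl : ℝ := 2 * (10 * (kGeo i).L * ((kGeo i).M * α₀)) * (1 + 10 * (kGeo i).L * ((kGeo i).M * α₀)) *
    Real.exp (4 * (10 * (kGeo i).L * ((kGeo i).M * α₀))) with hKpl
  have hL1 : (1 : ℝ) ≤ (kGeo i).L := B9Eq335PlaquetteAtLettersY.one_le_L i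
  have hKpl0 : 0 ≤ Kpl := by rw [hKpl]; positivity
  have hLk : (kGeo i).L = ((ℓ + 1 : ℕ) : ℝ) := rfl
  have hLj : (1 : ℝ) ≤ (kGeo i).L ^ levY i (chartY i x') := one_le_pow₀ hL1
  have hLj0 : (0 : ℝ) < (kGeo i).L ^ levY i (chartY i x') := lt_of_lt_of_le one_pos hLj
  have hsd0 : (0 : ℝ) ≤ (supDist x x' : ℝ) := Nat.cast_nonneg _
  rw [← hLk, Nat.cast_mul]
  have hinv : (((kGeo i).L ^ levY i (chartY i x'))⁻¹) ^ 2 ≤ ((kGeo i).L ^ levY i (chartY i x'))⁻¹ := by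
    rw [sq]
    exact mul_le_of_le_one_left (inv_nonneg.2 hLj0.le) (inv_le_one_of_one_le₀ hLj)
  have hd0 : (0 : ℝ) ≤ ((d + 1 : ℕ) : ℝ) := Nat.cast_nonneg _
  calc (((d + 1 : ℕ) : ℝ)) * (supDist x x' : ℝ) * (Kpl * ((kGeo i).L ^ 6 * (((kGeo i).L ^ levY i (chartY i x'))⁻¹) ^ 2))
      ≤ (((d + 1 : ℕ) : ℝ)) * (supDist x x' : ℝ) * (Kpl * ((kGeo i).L ^ 6 * ((kGeo i).L ^ levY i (chartY i x'))⁻¹)) := by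
        refine mul_le_mul_of_nonneg_left (mul_le_mul_of_nonneg_left (mul_le_mul_of_nonneg_left hinv (by positivity)) hKpl0) (mul_nonneg hd0 hsd0)
    _ = (((d + 1 : ℕ) : ℝ)) * Kpl * (kGeo i).L ^ 6 * ((supDist x x' : ℝ) / (kGeo i).L ^ levY i (chartY i x')) := by rw [div_eq_mul_inv]; ring

end Ladder

/-! ## §3 The Hölder-source members of `∇_{U,ν}G₀D_U` from the transported site class, one member and configuration -/

section Members

variable {X Y PX PY : Type} [Fintype X] [Fintype Y] [Fintype PX] [Fintype PY]

/-- ★★★ **`∇_{U,ν}∘G₀∘D_U` FROM THE TRANSPORTED SITE INPUT CLASS** (the statement of the certificate's `hdgDvd13` at `bHW := bHZPIfam (taxiS U)`): from the G₀ layer's (3.45)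
members at the transported BOND class `h44 : ∀ μ, HasMaj (bHZKPIfam (taxiB U) ε) (ofBlocks blk) (∇_{U,ν}∘(G₀∘∇\*_{U,μ})) (Bᵢe^{−δ₀d})` (`Thm33G0Dir.h44m`'s shape), the pinned direction
letter `Dds μ = coordOpK b (∇\*_{U,μ})` (so `D_U = Σ_μ Dds μ ∘ J_μ`, def-Y `DvcoKH_eq_sum`), the fam letter of §1 at rate `ρ + σ` (after the transfer loss `ε_t`), and a row sum
`RowSum σ c`: `HasMaj (bHZPIfam (taxiS U) ε) (ofBlocks blk) (∇_{U,ν}∘(G₀∘D_U)) (B·e^{−ρd})` for `0 ≤ ρ ≤ δ₀` and `B ≥ (d+1)·(1+C_Lip)·Bᵢ·C_J′·c`.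
[cite: Balaban1985BackgroundPropagators, Thm 3.3 (3.45) p.398 + (3.3) p.391 + (3.133) p.422 + (3.40) p.397; Balaban1984PropagatorsII, (2.52)–(2.56) pp.232–233 + Lemma 2.1 (2.60)–(2.61) p.234] -/
theorem hasMaj_dgDv_of_h44m [NormOneClass 𝔸] [FiniteDimensional ℝ 𝔸] (hG : GeoOK (geo9K i)) {σ c : ℝ} (hrow : RowSum (toB6 (geo9K i) R₀ H₀) σ c) (hσ : 0 ≤ σ)
    (hU : ∀ μ' t, UnitaryLike (cfg U₁ μ' t))
    (hβ1 : ∀ f : FBondY i, (geomT i.D).dist (β i.hN i.D i.hk (bI f)) (blkV1 i.hN i.D f) ≤ 1) (hcf : |i.cf| = (nKT (toKT i) : ℝ))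
    {εt : ℝ} (hεt : 0 < εt) (hM : Real.log (geo9K i).L ≤ εt * (2 * ((ℓ : ℝ) + 1) ^ 2 - 1) * (geo9K i).M) {Θ : ℝ} (hΘ : 0 ≤ Θ)
    (hlad : ∀ (μ : Fin (d + 1)) (x x' : Site (PV d ℓ i.m i.K hd hL) 0), Adm i ⟨x, μ⟩ ⟨x', μ⟩ →
      ‖((parTaxiV (cfg U₁) x x' * cfg U₁ μ x' * (parTaxiV (cfg U₁) (x.shift μ) (x'.shift μ))⁻¹ * (cfg U₁ μ x)⁻¹ : 𝔸ˣ) : 𝔸) - 1‖ ≤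
        Θ * ((supDist x x' : ℝ) / (((ℓ + 1 : ℕ) : ℝ)) ^ levY i (chartY i x')))
    {blk : Y → IBondY i} {G0 : Module.End ℝ (XBK κ i → ℝ)} {A : (XBK κ i → ℝ) →ₗ[ℝ] (Y → ℝ)} {Dds : Fin (d + 1) → Module.End ℝ (XBK κ i → ℝ)}
    (hDds : Dds = fun μ => coordOpK b (fun _ : Fin (d + 1) => cdsBₗ i (cfg U₁) μ))
    {ε Bi δ₀ ρ Bo : ℝ} (hε : 0 < ε) (hBi : 0 ≤ Bi) (hρ : 0 ≤ ρ) (hρ0 : ρ ≤ δ₀)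
    (h44 : ∀ μ : Fin (d + 1), HasMaj (bHZKPIfam (κ := κ) i b (taxiB i B cfg U₁) (R := R₀) (H := H₀) ε) (BlockNorm.ofBlocks (toB6 (geo9K i) R₀ H₀) blk)
      (A ∘ₗ (G0 ∘ₗ Dds μ)) (fun (a a' : IBondY i) => Bi * Real.exp (-(δ₀ * (geo9K i).dist a a'))))
    (hBo : (((d + 1 : ℕ) : ℝ)) * ((1 + CLip d ℓ) * Bi * ((((ℓ + 1 : ℕ) : ℝ)) * ((((ℓ + 1 : ℕ) : ℝ)) ^ 4 * coordBound39 b * basisBound39 b *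
      (3 + 2 * (((ℓ + 1 : ℕ) : ℝ)) ^ 2 + 2 * Θ * (((ℓ + 1 : ℕ) : ℝ)) ^ 3)) * Real.exp ((ρ + σ + εt) * (2 * (rNear d ℓ + 1) + 2 * (((d : ℝ) + 1) * (((ℓ : ℝ) + 1) + 1) + 2)))) * c) ≤ Bo) :
    HasMaj (bHZPIfam (κ := κ) i b (taxiS i B cfg U₁) (R := R₀) (H := H₀) ε) (BlockNorm.ofBlocks (toB6 (geo9K i) R₀ H₀) blk)
      (A ∘ₗ (G0 ∘ₗ DvcoKH i b B cfg U₁)) (fun (a a' : IBondY i) => Bo * Real.exp (-(ρ * (geo9K i).dist a a'))) := by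
  have hρσ : 0 ≤ ρ + σ + εt := by linarith
  have hJ := fun μ : Fin (d + 1) => hasMaj_JcoKH_fam (κ := κ) i b cfg U₁ (R₀ := R₀) (H₀ := H₀) (bI := bI) hU hβ1 hcf hρσ hεt hM μ hΘ (hlad μ) hε
  have hDv : DvcoKH i b B cfg U₁ = ∑ μ : Fin (d + 1), Dds μ ∘ₗ JcoKH i b B cfg μ U₁ := by rw [hDds]; exact DvcoKH_eq_sum i b B cfg U₁
  have hκ : (bHZKPIfam (κ := κ) i b (taxiB i B cfg U₁) (R := R₀) (H := H₀) ε).κ = 1 + CLip d ℓ := by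
    by_cases h1 : ε ≤ 1
    · rw [bHZKPIfam_of_mem i b _ hε.le h1]; rfl
    · rw [bHZKPIfam_of_not_mem i b _ (fun h => h1 h.2)]; rfl
  have hA' : ∀ μ : Fin (d + 1), HasMaj (bHZKPIfam (κ := κ) i b (taxiB i B cfg U₁) (R := R₀) (H := H₀) ε) (BlockNorm.ofBlocks (toB6 (geo9K i) R₀ H₀) blk)
      ((A ∘ₗ G0) ∘ₗ Dds μ) (fun (a a' : IBondY i) => Bi * Real.exp (-(δ₀ * (geo9K i).dist a a'))) := fun μ => h44 μ
  have hcb : 0 ≤ coordBound39 b := by unfold coordBound39; exact norm_nonneg _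
  have hbb : 0 ≤ basisBound39 b := Finset.sum_nonneg fun _ _ => norm_nonneg _
  have key := word_dv_of_members (g := geo9K i) (R₀ := R₀) (H₀ := H₀) hG hrow (P := Fin (d + 1)) (A := A ∘ₗ G0) (Dds := Dds)
    (J := fun μ => JcoKH i b B cfg μ U₁) (Dv := DvcoKH i b B cfg U₁) (B := Bo) hBi (by positivity) hρ hρ0 (by linarith) ?_ hDv hA' hJ
  · exact key
  · rw [Fintype.card_fin, hκ]
    calc (((d + 1 : ℕ) : ℝ)) * ((1 + CLip d ℓ) * Bi * ((((ℓ + 1 : ℕ) : ℝ)) * ((((ℓ + 1 : ℕ) : ℝ)) ^ 4 * coordBound39 b * basisBound39 b *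
          (3 + 2 * (((ℓ + 1 : ℕ) : ℝ)) ^ 2 + 2 * Θ * (((ℓ + 1 : ℕ) : ℝ)) ^ 3)) *
          Real.exp ((ρ + σ + εt) * (2 * (rNear d ℓ + 1) + 2 * (((d : ℝ) + 1) * (((ℓ : ℝ) + 1) + 1) + 2)))) * c)
        ≤ Bo := hBo

/-- ★★★ **`Φ^X_β∘∇_{U,ν}∘G₀∘D_U` FROM THE TRANSPORTED SITE INPUT CLASS** (the statement of the certificate's `hpdgDvd13` at `bHW := bHZPIfam (taxiS U)`): the same assembly with
the probe members `h45 : ∀ μ, HasMaj (bHZKPIfam (taxiB U) (β+ε)) (ofBlocks blkPX) (A∘(G₀∘∇\*_{U,μ})) (Bᵢ₂·(Lʲη)^{−β}·e^{−δ₀d})` (`Thm33G0Dir.h45m`'s shape, `A = Φ^X_β∘∇_{U,ν}`), the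
target-block factor `(Lʲη)^{−β}` riding along (`word_dv_of_members_tw`). [cite: Balaban1985BackgroundPropagators, Thm 3.3 (3.45) p.398 + (3.3) p.391 + (3.43) p.398; Balaban1984PropagatorsII, (2.52)–(2.56) pp.232–233 + Lemma 2.1 (2.60)–(2.61) p.234] -/
theorem hasMaj_pdgDv_of_h45m [NormOneClass 𝔸] [FiniteDimensional ℝ 𝔸] (hG : GeoOK (geo9K i)) {σ c : ℝ} (hrow : RowSum (toB6 (geo9K i) R₀ H₀) σ c) (hσ : 0 ≤ σ)
    (hU : ∀ μ' t, UnitaryLike (cfg U₁ μ' t))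
    (hβ1 : ∀ f : FBondY i, (geomT i.D).dist (β i.hN i.D i.hk (bI f)) (blkV1 i.hN i.D f) ≤ 1) (hcf : |i.cf| = (nKT (toKT i) : ℝ))
    {εt : ℝ} (hεt : 0 < εt) (hM : Real.log (geo9K i).L ≤ εt * (2 * ((ℓ : ℝ) + 1) ^ 2 - 1) * (geo9K i).M) {Θ : ℝ} (hΘ : 0 ≤ Θ)
    (hlad : ∀ (μ : Fin (d + 1)) (x x' : Site (PV d ℓ i.m i.K hd hL) 0), Adm i ⟨x, μ⟩ ⟨x', μ⟩ →
      ‖((parTaxiV (cfg U₁) x x' * cfg U₁ μ x' * (parTaxiV (cfg U₁) (x.shift μ) (x'.shift μ))⁻¹ * (cfg U₁ μ x)⁻¹ : 𝔸ˣ) : 𝔸) - 1‖ ≤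
        Θ * ((supDist x x' : ℝ) / (((ℓ + 1 : ℕ) : ℝ)) ^ levY i (chartY i x')))
    {blkP : PX → IBondY i} {G0 : Module.End ℝ (XBK κ i → ℝ)} {A : (XBK κ i → ℝ) →ₗ[ℝ] (PX → ℝ)} {Dds : Fin (d + 1) → Module.End ℝ (XBK κ i → ℝ)}
    (hDds : Dds = fun μ => coordOpK b (fun _ : Fin (d + 1) => cdsBₗ i (cfg U₁) μ))
    {ε βp Bi δ₀ ρ Bo : ℝ} (hε : 0 < ε) (hBi : 0 ≤ Bi) (hρ : 0 ≤ ρ) (hρ0 : ρ ≤ δ₀)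
    (h45 : ∀ μ : Fin (d + 1), HasMaj (bHZKPIfam (κ := κ) i b (taxiB i B cfg U₁) (R := R₀) (H := H₀) ε) (BlockNorm.ofBlocks (toB6 (geo9K i) R₀ H₀) blkP)
      (A ∘ₗ (G0 ∘ₗ Dds μ)) (fun (a a' : IBondY i) => Bi * (geo9K i).len a ^ (-βp) * Real.exp (-(δ₀ * (geo9K i).dist a a'))))
    (hBo : (((d + 1 : ℕ) : ℝ)) * ((1 + CLip d ℓ) * Bi * ((((ℓ + 1 : ℕ) : ℝ)) * ((((ℓ + 1 : ℕ) : ℝ)) ^ 4 * coordBound39 b * basisBound39 b *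
      (3 + 2 * (((ℓ + 1 : ℕ) : ℝ)) ^ 2 + 2 * Θ * (((ℓ + 1 : ℕ) : ℝ)) ^ 3)) * Real.exp ((ρ + σ + εt) * (2 * (rNear d ℓ + 1) + 2 * (((d : ℝ) + 1) * (((ℓ : ℝ) + 1) + 1) + 2)))) * c) ≤ Bo) :
    HasMaj (bHZPIfam (κ := κ) i b (taxiS i B cfg U₁) (R := R₀) (H := H₀) ε) (BlockNorm.ofBlocks (toB6 (geo9K i) R₀ H₀) blkP)
      (A ∘ₗ (G0 ∘ₗ DvcoKH i b B cfg U₁)) (fun (a a' : IBondY i) => Bo * (geo9K i).len a ^ (-βp) * Real.exp (-(ρ * (geo9K i).dist a a'))) := by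
  have hρσ : 0 ≤ ρ + σ + εt := by linarith
  have hJ := fun μ : Fin (d + 1) => hasMaj_JcoKH_fam (κ := κ) i b cfg U₁ (R₀ := R₀) (H₀ := H₀) (bI := bI) hU hβ1 hcf hρσ hεt hM μ hΘ (hlad μ) hε
  have hDv : DvcoKH i b B cfg U₁ = ∑ μ : Fin (d + 1), Dds μ ∘ₗ JcoKH i b B cfg μ U₁ := by rw [hDds]; exact DvcoKH_eq_sum i b B cfg U₁
  have hκ : (bHZKPIfam (κ := κ) i b (taxiB i B cfg U₁) (R := R₀) (H := H₀) ε).κ = 1 + CLip d ℓ := by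
    by_cases h1 : ε ≤ 1
    · rw [bHZKPIfam_of_mem i b _ hε.le h1]; rfl
    · rw [bHZKPIfam_of_not_mem i b _ (fun h => h1 h.2)]; rfl
  have hlen : ∀ a : IBondY i, 0 ≤ (geo9K i).len a ^ (-βp) := fun a => Real.rpow_nonneg (geo9K_len_pos i a).le _
  have hA' : ∀ μ : Fin (d + 1), HasMaj (bHZKPIfam (κ := κ) i b (taxiB i B cfg U₁) (R := R₀) (H := H₀) ε) (BlockNorm.ofBlocks (toB6 (geo9K i) R₀ H₀) blkP)
      ((A ∘ₗ G0) ∘ₗ Dds μ) (fun (a a' : IBondY i) => (geo9K i).len a ^ (-βp) * Bi * Real.exp (-(δ₀ * (geo9K i).dist a a'))) :=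
    fun μ => (h45 μ).mono fun a a' => le_of_eq (by ring)
  have hcb : 0 ≤ coordBound39 b := by unfold coordBound39; exact norm_nonneg _
  have hbb : 0 ≤ basisBound39 b := Finset.sum_nonneg fun _ _ => norm_nonneg _
  have key := word_dv_of_members_tw (g := geo9K i) (R₀ := R₀) (H₀ := H₀) hG hrow (P := Fin (d + 1)) (A := A ∘ₗ G0) (Dds := Dds)
    (J := fun μ => JcoKH i b B cfg μ U₁) (Dv := DvcoKH i b B cfg U₁) (B := Bo) hlen hBi (by positivity) hρ hρ0 (by linarith) ?_ hDv hA' hJ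
  · exact key.mono fun a a' => le_of_eq (by ring)
  · rw [Fintype.card_fin, hκ]
    exact hBo

end Members

/-! ## §4 (appended) The two class facts the certificate's W ∕ X slots display for the total families: `κ = 1 + C_Lip`, and the ℓ¹ control of localised inputs -/

section ClassFacts

open B11SectGGlobal (Size)
open B11SectGGlobalSizes
open B9MultiscaleSmoothPartitionY (NearY)

variable {R : ℝ} {H : Prop}

omit [CompleteSpace 𝔸] in
/-- `κ(bHZPIfam g ε) = 1 + C_Lip` for every `ε`. [cite: Balaban1984PropagatorsII, (2.52) p.232; Balaban1985BackgroundPropagators, (3.43) p.398] -/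
theorem bHZPIfam_κ (g : SiteY i → SiteY i → 𝔸ˣ) (ε : ℝ) : (bHZPIfam (κ := κ) i b g (R := R) (H := H) ε).κ = 1 + CLip d ℓ := by
  by_cases h : 0 ≤ ε ∧ ε ≤ 1
  · rw [bHZPIfam_of_mem i b g h.1 h.2]; rfl
  · rw [bHZPIfam_of_not_mem i b g h]; rfl

omit [CompleteSpace 𝔸] in
/-- `κ(bHZKPIfam g ε) = 1 + C_Lip` for every `ε`. [cite: Balaban1984PropagatorsII, (2.52) p.232; Balaban1985BackgroundPropagators, (3.43) p.398] -/
theorem bHZKPIfam_κ (g : FBondY i → FBondY i → 𝔸ˣ) (ε : ℝ) : (bHZKPIfam (κ := κ) i b g (R := R) (H := H) ε).κ = 1 + CLip d ℓ := by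
  by_cases h : 0 ≤ ε ∧ ε ≤ 1
  · rw [bHZKPIfam_of_mem i b g h.1 h.2]; rfl
  · rw [bHZKPIfam_of_not_mem i b g h]; rfl

omit [CompleteSpace 𝔸] in
/-- ℓ¹ control of a localised site input by the print-exact class size: `Σ_p |μ p| ≤ #XSK · loc y μ` (each value is below the unweighted sup channel `|λ|` of
`loc = |λ| + ‖λ‖^{ξ}_s`). [cite: Balaban1985BackgroundPropagators, (3.44) p.398, bookkeeping] -/
theorem sum_abs_le_loc_bHZPI (hcf : |i.cf| = (nKT (toKT i) : ℝ)) (g : SiteY i → SiteY i → 𝔸ˣ) {s : ℝ} (hs0 : 0 ≤ s) (hs1 : s ≤ 1)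
    (y : IBondY i) (μ : XSK κ i → ℝ) (hμ : (bHZPI (κ := κ) i b g (R := R) (H := H) hs0 hs1).IsLoc y μ) :
    ∑ p : XSK κ i, |μ p| ≤ (Fintype.card (XSK κ i) : ℝ) * (bHZPI (κ := κ) i b g (R := R) (H := H) hs0 hs1).loc y μ := by
  classical
  rw [B9SmoothHolderClassPI.bHZPI_isLoc_iff] at hμ
  have hS0 : 0 ≤ (Size.ofSup (toB6 (geo9K i) R H) (fun (q : XSK κ i) (y : IBondY i) => NearY i y q.1)).sz y μ := Size.nonneg _ _ _
  have hq : ∀ p : XSK κ i, |μ p| ≤ (bHZPI (κ := κ) i b g (R := R) (H := H) hs0 hs1).loc y μ := by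
    intro p
    rw [B9SmoothHolderClassPI.bHZPI_loc_print i b g hs0 hs1 hcf y μ]
    have hsup : |μ p| ≤ (Size.ofSup (toB6 (geo9K i) R H) (fun (q : XSK κ i) (y : IBondY i) => NearY i y q.1)).sz y μ := by
      by_cases h : NearY i y p.1
      · exact ofSup_abs_le (g := toB6 (geo9K i) R H) (fun (q : XSK κ i) (y : IBondY i) => NearY i y q.1) h μ
      · rw [hμ p h, abs_zero]; exact hS0
    exact hsup.trans (le_add_of_nonneg_right (mul_nonneg (Real.rpow_nonneg (geo9K_len_pos i y).le _) (Size.nonneg _ _ _)))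
  calc ∑ p : XSK κ i, |μ p| ≤ ∑ _p : XSK κ i, (bHZPI (κ := κ) i b g (R := R) (H := H) hs0 hs1).loc y μ := Finset.sum_le_sum fun p _ => hq p
    _ = (Fintype.card (XSK κ i) : ℝ) * (bHZPI (κ := κ) i b g (R := R) (H := H) hs0 hs1).loc y μ := by
        rw [Finset.sum_const, Finset.card_univ, nsmul_eq_mul]

omit [CompleteSpace 𝔸] in
/-- the bond twin: `Σ_q |μ q| ≤ #XBK · loc y μ` for a localised bond input in the print-exact bond class. [cite: Balaban1985BackgroundPropagators, (3.44) p.398, bookkeeping] -/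
theorem sum_abs_le_loc_bHZKPI (hcf : |i.cf| = (nKT (toKT i) : ℝ)) (g : FBondY i → FBondY i → 𝔸ˣ) {s : ℝ} (hs0 : 0 ≤ s) (hs1 : s ≤ 1)
    (y : IBondY i) (μ : XBK κ i → ℝ) (hμ : (bHZKPI (κ := κ) i b g (R := R) (H := H) hs0 hs1).IsLoc y μ) :
    ∑ q : XBK κ i, |μ q| ≤ (Fintype.card (XBK κ i) : ℝ) * (bHZKPI (κ := κ) i b g (R := R) (H := H) hs0 hs1).loc y μ := by
  classical
  rw [B9SmoothHolderClassPI.bHZKPI_isLoc_iff] at hμ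
  have hS0 : 0 ≤ (Size.ofSup (toB6 (geo9K i) R H) (fun (q : XBK κ i) (y : IBondY i) => NearY i y (B9SmoothHolderClassK.srcY i q))).sz y μ := Size.nonneg _ _ _
  have hq : ∀ p : XBK κ i, |μ p| ≤ (bHZKPI (κ := κ) i b g (R := R) (H := H) hs0 hs1).loc y μ := by
    intro p
    rw [B9SmoothHolderClassPI.bHZKPI_loc_print i b g hs0 hs1 hcf y μ]
    have hsup : |μ p| ≤ (Size.ofSup (toB6 (geo9K i) R H) (fun (q : XBK κ i) (y : IBondY i) => NearY i y (B9SmoothHolderClassK.srcY i q))).sz y μ := by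
      by_cases h : NearY i y (B9SmoothHolderClassK.srcY i p)
      · exact ofSup_abs_le (g := toB6 (geo9K i) R H) (fun (q : XBK κ i) (y : IBondY i) => NearY i y (B9SmoothHolderClassK.srcY i q)) h μ
      · rw [hμ p h, abs_zero]; exact hS0
    exact hsup.trans (le_add_of_nonneg_right (mul_nonneg (Real.rpow_nonneg (geo9K_len_pos i y).le _) (Size.nonneg _ _ _)))
  calc ∑ p : XBK κ i, |μ p| ≤ ∑ _p : XBK κ i, (bHZKPI (κ := κ) i b g (R := R) (H := H) hs0 hs1).loc y μ := Finset.sum_le_sum fun p _ => hq p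
    _ = (Fintype.card (XBK κ i) : ℝ) * (bHZKPI (κ := κ) i b g (R := R) (H := H) hs0 hs1).loc y μ := by
        rw [Finset.sum_const, Finset.card_univ, nsmul_eq_mul]

omit [CompleteSpace 𝔸] in
/-- ★ the `∃ Λ_W`-form the leaf binder `hdomW` displays, for the total site family, every `ε`. [cite: Balaban1985BackgroundPropagators, (3.44) p.398, bookkeeping] -/
theorem exists_l1_control_bHZPIfam (hcf : |i.cf| = (nKT (toKT i) : ℝ)) (g : SiteY i → SiteY i → 𝔸ˣ) (ε : ℝ) :
    ∃ ΛW : ℝ, 0 ≤ ΛW ∧ ∀ (y : IBondY i) (μ : XSK κ i → ℝ), (bHZPIfam (κ := κ) i b g (R := R) (H := H) ε).IsLoc y μ →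
      ∑ p : XSK κ i, |μ p| ≤ ΛW * (bHZPIfam (κ := κ) i b g (R := R) (H := H) ε).loc y μ := by
  refine ⟨Fintype.card (XSK κ i), Nat.cast_nonneg _, fun y μ hμ => ?_⟩
  by_cases h : 0 ≤ ε ∧ ε ≤ 1
  · rw [bHZPIfam_of_mem i b g h.1 h.2] at hμ ⊢; exact sum_abs_le_loc_bHZPI i b hcf g h.1 h.2 y μ hμ
  · rw [bHZPIfam_of_not_mem i b g h] at hμ ⊢; exact sum_abs_le_loc_bHZPI i b hcf g (by norm_num) (by norm_num) y μ hμ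

omit [CompleteSpace 𝔸] in
/-- ★ the `∃ Λ_X`-form the leaf binder `hdomX` displays, for the total bond family, every `ε`. [cite: Balaban1985BackgroundPropagators, (3.44) p.398, bookkeeping] -/
theorem exists_l1_control_bHZKPIfam (hcf : |i.cf| = (nKT (toKT i) : ℝ)) (g : FBondY i → FBondY i → 𝔸ˣ) (ε : ℝ) :
    ∃ ΛX : ℝ, 0 ≤ ΛX ∧ ∀ (y : IBondY i) (μ : XBK κ i → ℝ), (bHZKPIfam (κ := κ) i b g (R := R) (H := H) ε).IsLoc y μ →
      ∑ q : XBK κ i, |μ q| ≤ ΛX * (bHZKPIfam (κ := κ) i b g (R := R) (H := H) ε).loc y μ := by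
  refine ⟨Fintype.card (XBK κ i), Nat.cast_nonneg _, fun y μ hμ => ?_⟩
  by_cases h : 0 ≤ ε ∧ ε ≤ 1
  · rw [bHZKPIfam_of_mem i b g h.1 h.2] at hμ ⊢; exact sum_abs_le_loc_bHZKPI i b hcf g h.1 h.2 y μ hμ
  · rw [bHZKPIfam_of_not_mem i b g h] at hμ ⊢; exact sum_abs_le_loc_bHZKPI i b hcf g (by norm_num) (by norm_num) y μ hμ

end ClassFacts

end Literature.MathematicalPhysics.QuantumFieldTheory.Balaban1983to89.B9GradLetterTransportedInputClassesPI

end
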